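import Mathlib
import Literature.Analysis.FluidPDE.HardSphereCollisionRecord
import Literature.MathematicalPhysics.KineticTheory.HardSphereEuler
import Literature.MathematicalPhysics.KineticTheory.HardSphereEulerProofs
import Summits.AtomisticToContinuum.HydrodynamicLimit.Theses.OneFlightGossipEngine
import Summits.AtomisticToContinuum.HydrodynamicLimit.Theorems.OneFlightGossipEngineOneFlightLayeredChaosRegimes
import Summits.AtomisticToContinuum.HydrodynamicLimit.Theorems.OneFlightGossipEngineOneFlightLayeredChaosRecordGeometry
import Summits.AtomisticToContinuum.HydrodynamicLimit.Theorems.OneFlightGossipEngineOneFlightLayeredChaosFlightStartVel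
import Summits.AtomisticToContinuum.HydrodynamicLimit.Theorems.OneFlightGossipEngineOneFlightLayeredChaosIsotropy
import Summits.AtomisticToContinuum.HydrodynamicLimit.Theorems.OneFlightGossipEngineOneFlightLayeredChaosJunkInvisibility
import Summits.AtomisticToContinuum.HydrodynamicLimit.Theorems.OneFlightGossipEngineOneFlightLayeredChaosWindowEvent
import HarnessLib

/-!
# `OneFlightGossipEngine.OneFlightLayeredChaos` — flux-form regime frame and the kinematic transfer
(crux stmt-AtomisticToContinuum-14535, line `Sketch`, lead cycle c2; registered stub `stub_flux_transfer`)

The two open dynamical stubs of the line are statements about the IMPACT VECTOR `ω` of the `n`-th collision of a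
tagged hard sphere (⟺ the impact parameter on the `ε`-disc), never about the outgoing direction `ĝ_out` directly.
This file declares that flux form over the landed regime frame `Theorems.OLC` (`Regime`, `RegimeTail/Body`,
`rhoStar`) and proves the kinematic transfer back to the crux's own form:

* `OLC.RegimeFluxTail θ₀ σ bound X`, `OLC.RegimeFluxBody θ₀ X` — for every measurable `S ⊆ ℝ³ × ℝ³` and every
  event `E` of the coarse past `𝒢`, `|P(W ∩ {(ĝ, ω) ∈ S} ∩ (X ∩ E)) − ∫_{W ∩ (X ∩ E)} Flux_{ĝ(z)}(S_{ĝ(z)}) dP| ≤ bound`,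
  with `ĝ` the `𝒢`-measurable proxy of the incoming direction read off the two flight-start snapshots and `Flux_g`
  the normalised flux law `∝ (−⟪ω, g⟫)₊ dω` of the incoming hemisphere of `g` (mesh fixed at `ρ⋆(σ)`).
* `OLC.stub_flux_transfer : RegimeFluxBody θ₀ X → RegimeBody θ₀ X` for EVERY regime `X` (no measurability of `X`):
  apply the flux tail to the specular preimage `S_B = {(g, ω) | g − 2⟪ω, g⟫ω ∈ B}`. On `Φ.good ∩ W` the `n`-th
  record is a contact record with `ĝ_out = ĝ⁻ − 2⟪ω, ĝ⁻⟫ω` (`stub_record_geometry`) and `ĝ⁻ = ĝ`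
  (`stub_preVel_eq_flightStart_vel`), so the kick event `{ĝ_out ∈ B}` and `{(ĝ, ω) ∈ S_B}` differ inside the
  `P`-null set `goodᶜ` (`measure_inter_congr_of_symmDiff_null`); and the compensator integrand is the constant
  `u(B)` on `good ∩ W` by 3-D isotropy (`stub_isotropy` applied to `B` and to `univ`), so the compensator equals
  `u(B) · P(W ∩ (X ∩ E))` (a.e.-membership in `good ∩ W` under `P.restrict (W ∩ (X ∩ E))` from `P(goodᶜ) = 0` and
  outer-measure monotonicity; `setIntegral_const` needs no measurability of the set).
-/

open scoped BigOperators ENNReal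
open MeasureTheory Set
open Literature.Analysis.FluidPDE Literature.MathematicalPhysics.KineticTheory
open Summit.AtomisticToContinuum.HydrodynamicLimit.Theses.OneFlightGossipEngine

namespace Summit.AtomisticToContinuum.HydrodynamicLimit.Theorems.OLC

noncomputable section

/-! ## Flux-form regime frame (definitions) -/

/-- The FLUX-FORM tail of the crux on the regime `X` at activity `1`, temperature `θ₀`, mesh `ρ⋆(σ)`:
`∀ τ > 0 ∀ n ∃ N₀ ∀ N ≥ N₀ ∀ Φ i, ∀ S ⊆ ℝ³ × ℝ³ measurable, ∀ E ∈ 𝒢,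
|P(W ∩ {(ĝ, ω) ∈ S} ∩ (X ∩ E)) − ∫_{W ∩ (X ∩ E)} Flux_{ĝ(z)}(S_{ĝ(z)}) dP(z)| ≤ bound`, where `ω` is the impact vector of the
`n`-th collision record of `i`, `ĝ(z)` the normalised difference of the flight-start velocities of `i` and of its `n`-th
partner read off the coarse past (𝒢-measurable; `= inDir` on `Φ.good ∩ W`), `Flux_g(U) = ∫_U (−⟪ω,g⟫)₊ dω / ∫ (−⟪ω,g⟫)₊ dω`
the normalised flux law on the incoming hemisphere of `g`, `S_g = {ω | (g, ω) ∈ S}`; the other lets are the route decl's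
verbatim (lead-1's `stub_core`, mesh fixed at `ρ⋆`, window event cut down to `X`). [folklore] -/
def RegimeFluxTail (θ₀ σ bound : ℝ) (X : Regime) : Prop :=
  ∀ τ : ℝ, 0 < τ → ∀ n : ℕ, ∃ N₀ : ℕ, ∀ N : ℕ, N₀ ≤ N →
    ∀ Φ : HardSphereFlow (Torus.geometry (Fin 3)) (hsDiameter σ N) (N + 1),
    ∀ (i : Fin (N + 1)) (S : Set (V3 × V3)), MeasurableSet S →
    let G : Geometry (Fin 3) T3 := Torus.geometry (Fin 3)
    let ε : ℝ := hsDiameter σ N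
    let w : ℝ := τ * ((N + 1 : ℕ) : ℝ) ^ (-(1 / 3 : ℝ))
    let q : T3 → (Fin 3 → ℤ) := Torus.coarseCell (rhoStar σ * ((N + 1 : ℕ) : ℝ) ^ (-(1 / 3 : ℝ)))
    let P : Measure (Config (N + 1) (Fin 3) T3) := localGibbsLaw σ (fun _ => 1) (fun _ => 0) (fun _ => θ₀) N Φ
    let W : Set (Config (N + 1) (Fin 3) T3) :=
      {z | n + 1 ≤ Set.ncard (collisionTimesOf G ε (fun t => Φ.flow t z) i ∩ Set.Ioc 0 w)}
    let gIn : Config (N + 1) (Fin 3) T3 → V3 := fun z =>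
      ‖((Φ.coarsePastOf q i n z).1 i).2 - ((Φ.coarsePastOf q i n z).2 (Φ.nthPartnerOf i n z)).2‖⁻¹ •
        (((Φ.coarsePastOf q i n z).1 i).2 - ((Φ.coarsePastOf q i n z).2 (Φ.nthPartnerOf i n z)).2)
    let flux : V3 → Set V3 → ℝ := fun g U =>
      ((∫⁻ ω, U.indicator (fun _ => (1 : ℝ≥0∞)) (ω : V3) * ENNReal.ofReal (max (-inner ℝ (ω : V3) g) 0)
          ∂(sphereMeasure (E := V3))) /
        (∫⁻ ω, ENNReal.ofReal (max (-inner ℝ (ω : V3) g) 0) ∂(sphereMeasure (E := V3)))).toReal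
    ∀ E : Set (Config (N + 1) (Fin 3) T3),
      MeasurableSet[MeasurableSpace.comap (fun z => (Φ.coarsePastOf q i n z, Φ.nthPartnerOf i n z))
        inferInstance] E →
      |(P (W ∩ {z | (gIn z, (Φ.nthRecordOf i n z).impactVec) ∈ S} ∩ (X σ n N Φ i ∩ E))).toReal -
          ∫ z in W ∩ (X σ n N Φ i ∩ E), flux (gIn z) {ω | (gIn z, ω) ∈ S} ∂P| ≤ bound

/-- The FLUX-FORM body of the crux on the regime `X`: `∃ C p σ₀ > 0, ∀ σ ∈ (0, σ₀), RegimeFluxTail θ₀ σ (C σ^p) X` —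
"given the coarse past, the impact vector of the `n`-th collision is flux-distributed (⟺ the impact parameter is uniform on
the `ε`-disc) up to `C σ^p` in `L¹(𝒢)`, on the regime `X`, uniformly in `n, τ`, for `N ≥ N₀(σ, τ, n)`". [folklore] -/
def RegimeFluxBody (θ₀ : ℝ) (X : Regime) : Prop :=
  ∃ C : ℝ, 0 < C ∧ ∃ p : ℝ, 0 < p ∧ ∃ σ₀ : ℝ, 0 < σ₀ ∧ ∀ σ : ℝ, 0 < σ → σ < σ₀ →
    RegimeFluxTail θ₀ σ (C * σ ^ p) X

/-! ## Kinematic helpers -/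

/-- The set of pairs `(g, ω)` whose specular image `g − 2⟪ω, g⟫ω` lies in `B` is measurable. [folklore] -/
theorem measurableSet_specular_preimage {B : Set V3} (hB : MeasurableSet B) :
    MeasurableSet {x : V3 × V3 | x.1 - (2 * inner ℝ x.2 x.1) • x.2 ∈ B} := by
  -- adapted from the line's `Lines/SketchKinematic.lean` (lead -1), same statement
  have hc : Continuous fun x : V3 × V3 => x.1 - (2 * inner ℝ x.2 x.1) • x.2 := by
    fun_prop
  exact hc.measurable hB

/-- The normalised flux law of the incoming hemisphere of a unit vector `g` charges the specular preimage of `B`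
with the uniform probability of `B ∩ S²` (3-D isotropy `stub_isotropy` applied to `B` and to `univ`). [folklore] -/
theorem flux_specular_eq_uniform (g : V3) (hg : ‖g‖ = 1) {B : Set V3} (hB : MeasurableSet B) :
    ((∫⁻ ω, {ω' : V3 | g - (2 * inner ℝ ω' g) • ω' ∈ B}.indicator (fun _ => (1 : ℝ≥0∞)) (ω : V3) *
          ENNReal.ofReal (max (-inner ℝ (ω : V3) g) 0) ∂(sphereMeasure (E := V3))) /
        (∫⁻ ω, ENNReal.ofReal (max (-inner ℝ (ω : V3) g) 0) ∂(sphereMeasure (E := V3)))).toReal =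
      (((sphereMeasure (E := V3)) Set.univ)⁻¹ * (sphereMeasure (E := V3)) {ω | (ω : V3) ∈ B}).toReal := by
  -- adapted from the line's `Lines/SketchKinematic.lean` (lead -1), same statement
  have hB' := stub_isotropy g hg hB
  have hU' : ∫⁻ ω, ENNReal.ofReal (max (-inner ℝ (ω : V3) g) 0) ∂(sphereMeasure (E := V3)) =
      4⁻¹ * (sphereMeasure (E := V3)) Set.univ := by
    have hU := stub_isotropy g hg MeasurableSet.univ
    simpa using hU
  rw [hB', hU', ENNReal.mul_div_mul_left _ _ (by norm_num) (by norm_num), ENNReal.div_eq_inv_mul]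

/-- The global Gibbs law at activity `1` does not charge the bad set of the flow (it is absolutely continuous with
respect to the Liouville measure, and `Φ.good` is Liouville-conull). [folklore] -/
theorem localGibbsLaw_one_compl_good (σ θ₀ : ℝ) (N : ℕ)
    (Φ : HardSphereFlow (Torus.geometry (Fin 3)) (hsDiameter σ N) (N + 1)) :
    localGibbsLaw σ (fun _ => 1) (fun _ => 0) (fun _ => θ₀) N Φ Φ.goodᶜ = 0 := by
  rw [localGibbsLaw, particleLaw_eq]
  exact withDensity_absolutelyContinuous _ _ Φ.measure_compl_good

/-! ## The kinematic transfer -/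

/-- **Kinematic transfer** (registered stub `stub_flux_transfer` of crux stmt-AtomisticToContinuum-14535). For every
regime `X`, the flux-form body on `X` implies the crux's own body on `X`: apply the flux tail to the specular preimage
`S_B = {(g, ω) | g − 2⟪ω, g⟫ω ∈ B}`; on `Φ.good ∩ W` the `n`-th record is a contact record with
`ĝ_out = ĝ⁻ − 2⟪ω, ĝ⁻⟫ω` (`stub_record_geometry`) and `ĝ⁻ = gIn` (`stub_preVel_eq_flightStart_vel`), so the kick event
`{ĝ_out ∈ B}` and `{(gIn, ω) ∈ S_B}` differ inside `goodᶜ` (`P`-null; `measure_inter_congr_of_symmDiff_null`); and the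
compensator integrand `Flux_{gIn z}((S_B)_{gIn z})` is the constant `u(B)` on `good ∩ W` by 3-D isotropy
(`flux_specular_eq_uniform`), so the compensator is `u(B) · P(W ∩ (X ∩ E))` (`setIntegral_const`; a.e.-membership in
`good ∩ W` under `P.restrict (W ∩ (X ∩ E))` by `P(goodᶜ) = 0` and outer-measure monotonicity — no measurability of `X`
or `E` is needed). `σ₀` is shrunk to `min σ₀ ½` so that `ε = hsDiameter σ N < ½`. [folklore] -/
theorem stub_flux_transfer {θ₀ : ℝ} (X : Regime) (h : RegimeFluxBody θ₀ X) : RegimeBody θ₀ X := by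
  obtain ⟨C, hC, p, hp, σ₀, hσ₀, hcore⟩ := h
  refine ⟨C, hC, p, hp, min σ₀ 2⁻¹, lt_min hσ₀ (by norm_num), fun σ hσ hσlt => ?_⟩
  have hσ₀' : σ < σ₀ := hσlt.trans_le (min_le_left _ _)
  have hσ2 : σ < 2⁻¹ := hσlt.trans_le (min_le_right _ _)
  have hσtail := hcore σ hσ hσ₀'
  intro τ hτ n
  obtain ⟨N₀, hN₀⟩ := hσtail τ hτ n
  refine ⟨N₀, fun N hN Φ i B hB => ?_⟩
  intro G ε w q P W A u E hE
  have hεpos : 0 < ε := hsDiameter_pos hσ N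
  have hε2 : ε < 2⁻¹ := (hsDiameter_le hσ.le N).trans_lt hσ2
  -- the measurable set of pairs `(ĝ⁻, ω)` producing an outgoing direction in `B`
  set SB : Set (V3 × V3) := {x : V3 × V3 | x.1 - (2 * inner ℝ x.2 x.1) • x.2 ∈ B} with hSB
  have hSBm : MeasurableSet SB := measurableSet_specular_preimage hB
  have hmain := hN₀ N hN Φ i SB hSBm E hE
  -- the 𝒢-measurable proxy of the incoming direction
  set gIn : Config (N + 1) (Fin 3) T3 → V3 := fun z =>
      ‖((Φ.coarsePastOf q i n z).1 i).2 - ((Φ.coarsePastOf q i n z).2 (Φ.nthPartnerOf i n z)).2‖⁻¹ •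
        (((Φ.coarsePastOf q i n z).1 i).2 - ((Φ.coarsePastOf q i n z).2 (Φ.nthPartnerOf i n z)).2)
    with hgIn
  -- on `good ∩ W`: the record is a contact record and its incoming direction is `gIn`
  have hgeom : ∀ z ∈ Φ.good, z ∈ W →
      ‖(Φ.nthRecordOf i n z).impactVec‖ = 1 ∧ (Φ.nthRecordOf i n z).inDir = gIn z ∧ ‖gIn z‖ = 1 ∧
        ((Φ.nthRecordOf i n z).outDir ∈ B ↔ (gIn z, (Φ.nthRecordOf i n z).impactVec) ∈ SB) := by
    intro z hz hzW
    obtain ⟨h1, h2, -, h4⟩ := stub_record_geometry hεpos hε2 Φ i n w hz hzW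
    have hpre := stub_preVel_eq_flightStart_vel hεpos hε2 Φ q i n w hz hzW
    have hin : (Φ.nthRecordOf i n z).inDir = gIn z := by
      rw [hgIn, HardSphereCollisionRecord.inDir, hpre]
    refine ⟨h1, hin, by rw [← hin]; exact h2, ?_⟩
    rw [h4, hin, hSB]
    simp only [mem_setOf_eq]
  -- (a) the kick event and its `(ĝ, ω)`-form agree up to the null set `goodᶜ`
  have hnull : P Φ.goodᶜ = 0 := localGibbsLaw_one_compl_good σ θ₀ N Φ
  have hA : P (W ∩ A ∩ (X σ n N Φ i ∩ E)) =
      P (W ∩ {z | (gIn z, (Φ.nthRecordOf i n z).impactVec) ∈ SB} ∩ (X σ n N Φ i ∩ E)) := by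
    have hsd : symmDiff (W ∩ A) (W ∩ {z | (gIn z, (Φ.nthRecordOf i n z).impactVec) ∈ SB}) ⊆ Φ.goodᶜ := by
      intro z hz hzg
      rcases hz with ⟨⟨hzW, hzA⟩, hnot⟩ | ⟨⟨hzW, hzA'⟩, hnot⟩
      · exact hnot ⟨hzW, ((hgeom z hzg hzW).2.2.2).1 hzA⟩
      · exact hnot ⟨hzW, ((hgeom z hzg hzW).2.2.2).2 hzA'⟩
    have := measure_inter_congr_of_symmDiff_null P Φ.goodᶜ hnull hsd (X σ n N Φ i ∩ E)
    rw [show W ∩ A ∩ (X σ n N Φ i ∩ E) = (X σ n N Φ i ∩ E) ∩ (W ∩ A) from by rw [Set.inter_comm],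
      show W ∩ {z | (gIn z, (Φ.nthRecordOf i n z).impactVec) ∈ SB} ∩ (X σ n N Φ i ∩ E) =
        (X σ n N Φ i ∩ E) ∩ (W ∩ {z | (gIn z, (Φ.nthRecordOf i n z).impactVec) ∈ SB}) from by
          rw [Set.inter_comm]]
    exact this
  -- (b) the compensator is `u · P(W ∩ (X ∩ E))`: the integrand is the constant `u` on `good ∩ W`, and
  -- `P.restrict (W ∩ (X ∩ E))`-a.e. point lies in `good ∩ W` (outer-measure monotonicity; `good ∩ W` is measurable)
  have hWm : MeasurableSet (Φ.good ∩ W) := measurableSet_good_inter_le_ncard_collisionTimesOf Φ i (n + 1) w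
  have hae : ∀ᵐ z ∂(P.restrict (W ∩ (X σ n N Φ i ∩ E))), z ∈ Φ.good ∩ W := by
    rw [ae_iff]
    refine measure_mono_null (t := (Φ.good ∩ W)ᶜ) (fun z hz => hz) ?_
    rw [Measure.restrict_apply hWm.compl]
    exact measure_mono_null (fun z hz hg => hz.1 ⟨hg, hz.2.1⟩) hnull
  have hflux : ∀ z ∈ Φ.good, z ∈ W →
      ((∫⁻ ω, {ω | (gIn z, ω) ∈ SB}.indicator (fun _ => (1 : ℝ≥0∞)) (ω : V3) *
            ENNReal.ofReal (max (-inner ℝ (ω : V3) (gIn z)) 0) ∂(sphereMeasure (E := V3))) /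
          (∫⁻ ω, ENNReal.ofReal (max (-inner ℝ (ω : V3) (gIn z)) 0) ∂(sphereMeasure (E := V3)))).toReal = u := by
    intro z hz hzW
    have hunit : ‖gIn z‖ = 1 := (hgeom z hz hzW).2.2.1
    have hset : {ω | (gIn z, ω) ∈ SB} = {ω' : V3 | gIn z - (2 * inner ℝ ω' (gIn z)) • ω' ∈ B} :=
      Set.ext fun _ => Iff.rfl
    rw [hset]
    exact flux_specular_eq_uniform (gIn z) hunit hB
  have hcomp : ∫ z in W ∩ (X σ n N Φ i ∩ E),
      ((∫⁻ ω, {ω | (gIn z, ω) ∈ SB}.indicator (fun _ => (1 : ℝ≥0∞)) (ω : V3) *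
            ENNReal.ofReal (max (-inner ℝ (ω : V3) (gIn z)) 0) ∂(sphereMeasure (E := V3))) /
          (∫⁻ ω, ENNReal.ofReal (max (-inner ℝ (ω : V3) (gIn z)) 0) ∂(sphereMeasure (E := V3)))).toReal ∂P =
      u * (P (W ∩ (X σ n N Φ i ∩ E))).toReal := by
    have hcongr : (fun z => ((∫⁻ ω, {ω | (gIn z, ω) ∈ SB}.indicator (fun _ => (1 : ℝ≥0∞)) (ω : V3) *
            ENNReal.ofReal (max (-inner ℝ (ω : V3) (gIn z)) 0) ∂(sphereMeasure (E := V3))) /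
          (∫⁻ ω, ENNReal.ofReal (max (-inner ℝ (ω : V3) (gIn z)) 0) ∂(sphereMeasure (E := V3)))).toReal)
        =ᵐ[P.restrict (W ∩ (X σ n N Φ i ∩ E))] fun _ => u := by
      filter_upwards [hae] with z hz
      exact hflux z hz.1 hz.2
    rw [integral_congr_ae hcongr, setIntegral_const, smul_eq_mul, mul_comm]
    rfl
  -- assemble
  have hmain' : |(P (W ∩ {z | (gIn z, (Φ.nthRecordOf i n z).impactVec) ∈ SB} ∩ (X σ n N Φ i ∩ E))).toReal -
      ∫ z in W ∩ (X σ n N Φ i ∩ E),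
        ((∫⁻ ω, {ω | (gIn z, ω) ∈ SB}.indicator (fun _ => (1 : ℝ≥0∞)) (ω : V3) *
            ENNReal.ofReal (max (-inner ℝ (ω : V3) (gIn z)) 0) ∂(sphereMeasure (E := V3))) /
          (∫⁻ ω, ENNReal.ofReal (max (-inner ℝ (ω : V3) (gIn z)) 0) ∂(sphereMeasure (E := V3)))).toReal ∂P|
        ≤ C * σ ^ p := hmain
  rw [hA, ← hcomp]
  exact hmain'

end

end Summit.AtomisticToContinuum.HydrodynamicLimit.Theorems.OLC
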